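import Summits.BirchSwinnertonDyer.BirchSwinnertonDyer.Theorems.ClassRecordThreeEulerHalvesAtThreeEichlerShimuraLevelCountB
import HarnessLib

/-!
# The Shapiro count of parabolic cocycles for a general finite-index level `Γ ∋ -1`, part C:
# the comparison map and the count `6 dim H¹_P(Γ, ℝ) + 3ε₂ + 4ε₃ + 6ε_∞ ≤ 12 + [SL(2, ℤ) : Γ]`

Conclusion of the port of the tree's `ParabolicCount` (`ModularSymbolsParabolicCohomologyProofs`) to
an arbitrary finite-index level `Γ ≤ SL(2, ℤ)` with `-1 ∈ Γ` (`…EichlerShimuraLevelCountA/B`): the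
comparison map `Λ(u, f) = ((E_u + δf)(S), (E_u + δf)(T))` on `H¹_P(Γ, ℝ) ⊕ ℝ^X`, its kernel
`0 ⊕ (constants)`, the solution space of the three linear conditions, and the count

  `6 dim_ℝ H¹_P(Γ, ℝ) + 3ε₂ + 4ε₃ + 6ε_∞ ≤ 12 + [SL(2, ℤ) : Γ]`
    (`six_mul_finrank_parabolicCocycles_le`),

with `ε₂ = Level.nu₂Level Γ = #{x : Sx = x}`, `ε₃ = Level.nu₃Level Γ = #{x : STx = x}` and
`ε_∞ = #Level.basePoints Γ` (the number of `⟨T⟩`-orbits on `SL(2, ℤ)/Γ`) — the inequality half of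
Shimura's `dim H¹_P(Γ, ℝ) = 2g` ((8.2.24), `n = 0`), in exactly the quantities that enter the
dimension formulas of `ModularFormsGamma1Dimension` (`Γ = ±Γ₁(N)`: `ε₂ = ε₃ = 0`). Also:
`finiteDimensional_parabolicCocycles` (`u ↦ (E_u(S), E_u(T))` is injective). All proofs are those of
`ParabolicCount`; no named facts.

## References

* G. Shimura, *Introduction to the arithmetic theory of automorphic functions* (1971), §8.2,
  (8.2.24) with Prop. 8.3 (case `n = 0`), Thm. 8.4.
* K. S. Brown, *Cohomology of groups*, GTM 87 (1982), III.6.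
-/

noncomputable section

open scoped MatrixGroups ModularForm

open CongruenceSubgroup Matrix.SpecialLinearGroup ModularGroup

set_option linter.dupNamespace false

namespace Summit.BirchSwinnertonDyer.BirchSwinnertonDyer.Theorems.EichlerShimuraLevel

open _root_.Module _root_.LinearMap
open Literature.NumberTheory.EllipticCurves.ModularForms
open scoped Classical

variable {Γ : Subgroup SL(2, ℤ)}

/-! ### The comparison map `u ⊕ f ↦ ((E_u + δf)(S), (E_u + δf)(T))` and its kernel -/

variable (Γ)

/-- `u ↦ (E_u(S), E_u(T))`. [folklore] -/
def liftPair : parabolicCocycles Γ →ₗ[ℝ] ((SL(2, ℤ) ⧸ Γ) → ℝ) × ((SL(2, ℤ) ⧸ Γ) → ℝ) where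
  toFun u := (lift (u : Γ → ℝ) S, lift (u : Γ → ℝ) T)
  map_add' u v := by
    ext x <;> simp
  map_smul' c u := by
    ext x <;> simp

/-- `f ↦ (δf(S), δf(T))`. [folklore] -/
def cobdPair : ((SL(2, ℤ) ⧸ Γ) → ℝ) →ₗ[ℝ] ((SL(2, ℤ) ⧸ Γ) → ℝ) × ((SL(2, ℤ) ⧸ Γ) → ℝ) where
  toFun f := (cobd f S, cobd f T)
  map_add' f f' := by
    ext x <;> simp [cobd] <;> ring
  map_smul' c f := by
    ext x <;> simp [cobd] <;> ring

/-- The **comparison map** `Λ(u, f) = ((E_u + δf)(S), (E_u + δf)(T))` on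
`H¹_P(Γ, ℝ) ⊕ ℝ^X`. [folklore] -/
def lam : (parabolicCocycles Γ × ((SL(2, ℤ) ⧸ Γ) → ℝ)) →ₗ[ℝ] ((SL(2, ℤ) ⧸ Γ) → ℝ) × ((SL(2, ℤ) ⧸ Γ) → ℝ) :=
  (liftPair Γ).coprod (cobdPair Γ)

/-- Unfolding `lam`. [folklore] -/
theorem lam_apply (p : parabolicCocycles Γ × ((SL(2, ℤ) ⧸ Γ) → ℝ)) :
    lam Γ p = (tot (p.1 : Γ → ℝ) p.2 S, tot (p.1 : Γ → ℝ) p.2 T) := rfl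

/-- **The kernel of `Λ` is `0 ⊕ (constants)`**: if `(E_u + δf)(S) = (E_u + δf)(T) = 0` then
`E_u + δf = 0` on `SL(2, ℤ) = ⟨S, T⟩`, so `u(γ) = (E_u + δf)(γ)(Γ) = 0`, and then `g^*f = f` for
all `g`, i.e. `f` is constant (`SL(2, ℤ)` is transitive on `X`). [folklore] -/
theorem ker_lam_le (p : parabolicCocycles Γ × ((SL(2, ℤ) ⧸ Γ) → ℝ)) (hp : p ∈ LinearMap.ker (lam Γ)) :
    p.1 = 0 ∧ ∀ x, p.2 x = p.2 ((1 : SL(2, ℤ)) : (SL(2, ℤ) ⧸ Γ)) := by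
  obtain ⟨u, f⟩ := p
  have hu := (mem_parabolicCocycles_iff.mp u.2).1
  rw [LinearMap.mem_ker, lam_apply, Prod.mk_eq_zero] at hp
  have hall := tot_eq_zero_of_S_T hu f hp.1 hp.2
  have hu0 : u = 0 := by
    apply Subtype.ext
    funext γ
    have h := tot_apply_coe_one hu f γ
    rw [hall, Pi.zero_apply] at h
    simp [← h]
  refine ⟨hu0, fun x ↦ ?_⟩
  have hcobd : ∀ g, cobd f g = 0 := fun g ↦ by
    have h := hall g
    rw [tot, hu0] at h
    have h0 : lift ((0 : parabolicCocycles Γ) : Γ → ℝ) g = 0 := by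
      funext y
      simp
    rwa [h0, zero_add] at h
  have hx : x = sec x • ((1 : SL(2, ℤ)) : (SL(2, ℤ) ⧸ Γ)) := by
    rw [MulAction.Quotient.smul_mk, smul_eq_mul, mul_one, coe_sec]
  have h := congr_fun (hcobd (sec x)) ((1 : SL(2, ℤ)) : (SL(2, ℤ) ⧸ Γ))
  rw [cobd, Pi.sub_apply, coperm_apply, Pi.zero_apply, sub_eq_zero, ← hx] at h
  exact h

/-- `u ↦ (E_u(S), E_u(T))` is injective (`Λ(u, 0) = 0` forces `u = 0`). [folklore] -/
theorem liftPair_injective : Function.Injective (liftPair Γ) := by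
  intro u v h
  have hk : ((u - v, (0 : (SL(2, ℤ) ⧸ Γ) → ℝ)) : parabolicCocycles Γ × ((SL(2, ℤ) ⧸ Γ) → ℝ)) ∈ LinearMap.ker (lam Γ) := by
    rw [LinearMap.mem_ker, lam, LinearMap.coprod_apply, map_zero, add_zero, map_sub, h, sub_self]
  exact sub_eq_zero.mp (ker_lam_le Γ _ hk).1

/-- **`H¹_P(Γ, ℝ)` is finite-dimensional** for a finite-index `Γ` (it embeds into `ℝ^X × ℝ^X` by
`u ↦ (E_u(S), E_u(T))`). [folklore] -/
theorem finiteDimensional_parabolicCocycles [Γ.FiniteIndex] :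
    FiniteDimensional ℝ (parabolicCocycles Γ) :=
  Module.Finite.of_injective (liftPair Γ) (liftPair_injective Γ)

/-- `dim ker Λ ≤ 1`. [folklore] -/
theorem finrank_ker_lam_le_one : finrank ℝ (LinearMap.ker (lam Γ)) ≤ 1 := by
  let φ : LinearMap.ker (lam Γ) →ₗ[ℝ] ℝ :=
    { toFun := fun p ↦ (p : parabolicCocycles Γ × ((SL(2, ℤ) ⧸ Γ) → ℝ)).2 ((1 : SL(2, ℤ)) : (SL(2, ℤ) ⧸ Γ))
      map_add' := fun _ _ ↦ rfl
      map_smul' := fun _ _ ↦ rfl }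
  have hφ : Function.Injective φ := by
    intro p q hpq
    obtain ⟨hp1, hp2⟩ := ker_lam_le Γ p.1 p.2
    obtain ⟨hq1, hq2⟩ := ker_lam_le Γ q.1 q.2
    apply Subtype.ext
    apply Prod.ext
    · rw [hp1, hq1]
    · funext x
      rw [hp2 x, hq2 x]
      exact hpq
  have h := LinearMap.finrank_le_finrank_of_injective hφ
  rwa [Module.finrank_self] at h

/-! ### The three linear conditions on `((E_u + δf)(S), (E_u + δf)(T))` and their solution space -/

section Finite

variable [Γ.FiniteIndex]

/-- The **solution space** `W ⊆ ℝ^X × ℝ^X` of `(1 + S^*)a = 0`,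
`(1 + (ST)^* + (ST)^{*2})(T^*a + b) = 0`, `cusp sums of b = 0`. [folklore] -/
def solSpace : Submodule ℝ (((SL(2, ℤ) ⧸ Γ) → ℝ) × ((SL(2, ℤ) ⧸ Γ) → ℝ)) :=
  LinearMap.ker (relS Γ ∘ₗ LinearMap.fst ℝ _ _) ⊓
    (LinearMap.ker (relST Γ ∘ₗ (coperm Γ T ∘ₗ LinearMap.fst ℝ _ _ + LinearMap.snd ℝ _ _)) ⊓
      LinearMap.ker (cuspSum Γ ∘ₗ LinearMap.snd ℝ _ _))

/-- Membership in `solSpace`. [folklore] -/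
theorem mem_solSpace_iff (p : ((SL(2, ℤ) ⧸ Γ) → ℝ) × ((SL(2, ℤ) ⧸ Γ) → ℝ)) :
    p ∈ solSpace Γ ↔ relS Γ p.1 = 0 ∧ relST Γ (coperm Γ T p.1 + p.2) = 0 ∧ cuspSum Γ p.2 = 0 := by
  simp [solSpace]

/-- **`Λ` lands in the solution space**: `(1 + S^*)E(S) = E(S²) = E(-1) = 0`,
`(1 + U + U²)(T^*E(S) + E(T)) = (1 + U + U²)E(ST) = E((ST)³) = E(-1) = 0`, and the cusp sums of
`E(T) = E_u(T) + T^*f - f` vanish (`cuspSum_lift_T`, `cuspSum_coperm_T`). [folklore] -/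
theorem range_lam_le [Fact ((-1 : SL(2, ℤ)) ∈ Γ)] : LinearMap.range (lam Γ) ≤ solSpace Γ := by
  rintro _ ⟨⟨u, f⟩, rfl⟩
  have hu := (mem_parabolicCocycles_iff.mp u.2).1
  rw [mem_solSpace_iff, lam_apply]
  refine ⟨?_, ?_, ?_⟩
  · have h := tot_mul hu f S S
    rw [S_mul_S_eq_neg_one, tot_neg_one hu] at h
    rw [relS, LinearMap.add_apply, LinearMap.id_apply, add_comm]
    exact h.symm
  · have h3 := tot_mul hu f (S * T * (S * T)) (S * T)
    rw [ParabolicCount.ST_pow_three_eq, tot_neg_one hu, tot_mul hu f (S * T) (S * T), map_add] at h3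
    change relST Γ (coperm Γ T (tot (u : Γ → ℝ) f S) + tot (u : Γ → ℝ) f T) = 0
    rw [← tot_mul hu f S T, relST]
    simp only [LinearMap.add_apply, LinearMap.id_apply, LinearMap.comp_apply]
    rw [eq_comm] at h3
    convert h3 using 1
    abel
  · change cuspSum Γ (tot (u : Γ → ℝ) f T) = 0
    rw [tot, map_add, cuspSum_lift_T u, zero_add, cobd, map_sub, cuspSum_coperm_T, sub_self]

/-- **`dim W ≤ dim ker(1 + S^*) + dim(ker(1 + U + U²) ∩ ker(cusp sums))`**: project `W` to the
first factor; the fibre over `a = 0` is `ker(1 + U + U²) ∩ ker(cusp sums)`. [folklore] -/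
theorem finrank_solSpace_le :
    finrank ℝ (solSpace Γ) ≤ finrank ℝ (LinearMap.ker (relS Γ)) +
      finrank ℝ ↥(LinearMap.ker (relST Γ) ⊓ LinearMap.ker (cuspSum Γ)) := by
  let π : solSpace Γ →ₗ[ℝ] ((SL(2, ℤ) ⧸ Γ) → ℝ) := LinearMap.fst ℝ _ _ ∘ₗ (solSpace Γ).subtype
  have hπ := LinearMap.finrank_range_add_finrank_ker π
  have hrange : LinearMap.range π ≤ LinearMap.ker (relS Γ) := by
    rintro _ ⟨p, rfl⟩
    exact ((mem_solSpace_iff Γ p.1).mp p.2).1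
  have h1 := Submodule.finrank_mono hrange
  let ψ : LinearMap.ker π →ₗ[ℝ] ((SL(2, ℤ) ⧸ Γ) → ℝ) :=
    LinearMap.snd ℝ _ _ ∘ₗ (solSpace Γ).subtype ∘ₗ (LinearMap.ker π).subtype
  have hker : ∀ p : LinearMap.ker π,
      ((p : solSpace Γ) : ((SL(2, ℤ) ⧸ Γ) → ℝ) × ((SL(2, ℤ) ⧸ Γ) → ℝ)).1 = 0 :=
    fun p ↦ LinearMap.mem_ker.mp p.2
  have hψinj : Function.Injective ψ := by
    intro p q hpq
    apply Subtype.ext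
    apply Subtype.ext
    exact Prod.ext (by rw [hker p, hker q]) hpq
  have hψrange : LinearMap.range ψ ≤ LinearMap.ker (relST Γ) ⊓ LinearMap.ker (cuspSum Γ) := by
    rintro _ ⟨p, rfl⟩
    obtain ⟨-, h2, h3⟩ := (mem_solSpace_iff Γ _).mp (p : solSpace Γ).2
    rw [hker p, map_zero, zero_add] at h2
    exact ⟨h2, h3⟩
  have h2 := Submodule.finrank_mono hψrange
  rw [LinearMap.finrank_range_of_inj hψinj] at h2
  omega

/-! ### The count -/

/-- **`6 dim_ℝ H¹_P(Γ, ℝ) + 3ε₂ + 4ε₃ + 6ε_∞ ≤ 12 + [SL(2, ℤ) : Γ]`** for a finite-index level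
`Γ ∋ -1`, with `ε₂ = Level.nu₂Level Γ = #{x ∈ SL(2, ℤ)/Γ : Sx = x}`,
`ε₃ = Level.nu₃Level Γ = #{x : STx = x}`, `ε_∞ = #Level.basePoints Γ` the number of `⟨T⟩`-orbits
(so that `2g = 2 + μ/6 - ε₂/2 - 2ε₃/3 - ε_∞`): the inequality half of Shimura's count
`dim H¹_P(Γ, ℝ) = 2g` ((8.2.24) for `n = 0`, Prop. 8.3), by Shapiro's lemma and linear algebra in
`ℝ^X`: `dim H¹_P + μ ≤ dim ker Λ + dim W ≤ 1 + (μ - rk(1 + S^*)) + (μ - rk(1 + U + U²)) +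
(μ - ε_∞) + 1 - μ` with `2 rk(1 + S^*) = μ + ε₂`, `3 rk(1 + U + U²) = μ + 2ε₃`. The tree's
`ParabolicCount.six_mul_finrank_parabolicCocycles_le` is the case `Γ = Γ₀(N)`.
[cite: ShimuraIATAF1971, §8.2 (8.2.24) with Prop. 8.3 (case n = 0)] -/
theorem six_mul_finrank_parabolicCocycles_le (hneg : (-1 : SL(2, ℤ)) ∈ Γ) :
    6 * finrank ℝ (parabolicCocycles Γ) + 3 * Level.nu₂Level Γ + 4 * Level.nu₃Level Γ +
        6 * (Level.basePoints Γ).card ≤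
      12 + Γ.index := by
  letI : Fintype (SL(2, ℤ) ⧸ Γ) := Fintype.ofFinite _
  haveI : Fact ((-1 : SL(2, ℤ)) ∈ Γ) := ⟨hneg⟩
  haveI : FiniteDimensional ℝ (parabolicCocycles Γ) := finiteDimensional_parabolicCocycles Γ
  -- notation and the numerical inputs
  have hμ : Γ.index = Fintype.card (SL(2, ℤ) ⧸ Γ) := by
    rw [Subgroup.index, Nat.card_eq_fintype_card]
  have hε₂ : Level.nu₂Level Γ = (Finset.univ.filter fun q : (SL(2, ℤ) ⧸ Γ) ↦ S • q = q).card := by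
    rw [Level.nu₂Level, Nat.card_eq_fintype_card, Fintype.card_subtype]
  have hε₃ : Level.nu₃Level Γ = (Finset.univ.filter fun q : (SL(2, ℤ) ⧸ Γ) ↦ (S * T) • q = q).card := by
    rw [Level.nu₃Level, Nat.card_eq_fintype_card, Fintype.card_subtype]
  have hS := two_mul_finrank_range_relS (Γ := Γ)
  have hST := three_mul_finrank_range_relST (Γ := Γ)
  have hC := finrank_range_cuspSum (Γ := Γ)
  -- rank–nullity for the three operators
  have hS' := LinearMap.finrank_range_add_finrank_ker (relS Γ)
  have hST' := LinearMap.finrank_range_add_finrank_ker (relST Γ)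
  have hC' := LinearMap.finrank_range_add_finrank_ker (cuspSum Γ)
  rw [finrank_fintype_fun_eq_card] at hS' hST' hC'
  -- `dim (ker U ∩ ker C) + μ ≤ dim ker U + dim ker C + 1`
  have hsup := Submodule.finrank_sup_add_finrank_inf_eq (LinearMap.ker (relST Γ))
    (LinearMap.ker (cuspSum Γ))
  have hcodim := card_le_finrank_ker_sup_add_one (Γ := Γ)
  -- `dim H¹_P + μ = dim ker Λ + dim range Λ ≤ 1 + dim W`
  have hΛ := LinearMap.finrank_range_add_finrank_ker (lam Γ)
  rw [Module.finrank_prod, finrank_fintype_fun_eq_card] at hΛ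
  have hker := finrank_ker_lam_le_one Γ
  have hrange := Submodule.finrank_mono (range_lam_le Γ)
  have hW := finrank_solSpace_le Γ
  rw [hμ, hε₂, hε₃]
  omega

end Finite

end Summit.BirchSwinnertonDyer.BirchSwinnertonDyer.Theorems.EichlerShimuraLevel

end
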